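import Summits.AtomisticToContinuum.FouriersLaw.Theorems.EmbeddedDrudeMourreDrudeDissolutionStubHarmonicPencilAlgebraGreen
import Literature.MathematicalPhysics.KineticTheory.HarmonicChaosDecomposition
import HarnessLib

/-!
# Bounds on the lattice Green function of `ω₂ − Δ`; bounded lattice solutions
(helper file of stub `stub_harmonicStein` (K1) of line `gram-pencil-harmonic-chaos`, crux
`EmbeddedDrudeMourre.DrudeDissolution`, item stmt-AtomisticToContinuum-12593; `--supports` file,
closes nothing; registered helper theorem `harmonicStein_greenLattice`)

WHAT. For `ω₂ > 0` and `G = HarmonicChaos.greenFn ω₂` (`G(x) = ∫_𝕋 Re e^{ikx} / ω(k)² dk`,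
`ω(k)² = ω₂ + 2 − 2cos k`):
* `abs_greenFn_le` — `|G(x)| ≤ 1/ω₂`;
* `eq_zero_of_bounded_of_lattice_eq` — a BOUNDED solution `d : ℤ → ℝ` of `(ω₂ − Δ) d = 0` vanishes
  (no bounded lattice mode for `ω₂ > 0`: `(ω₂+2) sup|d| ≤ 2 sup|d|`);
* `harmonicStein_greenLattice` — the lattice equation `(ω₂ + 2) G(x) − G(x+1) − G(x−1) = [x = 0]`,
  restated from the sibling file `…StubHarmonicPencilAlgebraGreen` (`greenFn_harmonic_identity`).

HOW. `ω(k)² ≥ ω₂` and `|e^{ikx}| = 1`; the supremum argument for the bounded mode.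
-/

noncomputable section

namespace Summit.AtomisticToContinuum.FouriersLaw.Theorems.DrudeDissolution.GramPencilHarmonicChaos

open MeasureTheory Filter Set Function Topology
open scoped ComplexConjugate
open Literature.MathematicalPhysics.KineticTheory
open Literature.MathematicalPhysics.KineticTheory.HeatConduction
open HarmonicChaos

section Green

open PinnedChainKinetic

/-! ## Bounds on the Green function -/

/-- `ω₂ ≤ ω(k)²`. [folklore] -/
theorem le_dispersion_sq {ω₂ : ℝ} (hω : 0 ≤ ω₂) (k : 𝕋) : ω₂ ≤ dispersion ω₂ k ^ 2 := by
  rw [dispersion_sq_eq hω]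
  have := (abs_le.1 (abs_cosT_le_one k)).2
  linarith

/-- The integrand of the Green function is bounded by `1/ω₂`. [folklore] -/
theorem abs_greenIntegrand_le {ω₂ : ℝ} (hω : 0 < ω₂) (x : ℤ) (k : 𝕋) :
    |((fourier x k : ℂ)).re / dispersion ω₂ k ^ 2| ≤ 1 / ω₂ := by
  have hre : |((fourier x k : ℂ)).re| ≤ 1 := by
    have h1 : |((fourier x k : ℂ)).re| ≤ ‖(fourier x k : ℂ)‖ := Complex.abs_re_le_norm _
    have h2 : ‖(fourier x k : ℂ)‖ = 1 := Circle.norm_coe _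
    linarith
  have hd : ω₂ ≤ dispersion ω₂ k ^ 2 := le_dispersion_sq hω.le k
  rw [abs_div, abs_of_pos (lt_of_lt_of_le hω hd)]
  calc |((fourier x k : ℂ)).re| / dispersion ω₂ k ^ 2 ≤ 1 / dispersion ω₂ k ^ 2 :=
        div_le_div_of_nonneg_right hre (lt_of_lt_of_le hω hd).le
    _ ≤ 1 / ω₂ := one_div_le_one_div_of_le hω hd

/-- **`|G(x)| ≤ 1/ω₂`** for the lattice Green function `G = greenFn ω₂`, `ω₂ > 0`. [folklore] -/
theorem abs_greenFn_le {ω₂ : ℝ} (hω : 0 < ω₂) (x : ℤ) : |greenFn ω₂ x| ≤ 1 / ω₂ := by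
  unfold greenFn
  have h := norm_integral_le_of_norm_le_const (μ := μ𝕋)
    (f := fun k : 𝕋 => ((fourier x k : ℂ)).re / dispersion ω₂ k ^ 2) (C := 1 / ω₂)
    (Eventually.of_forall fun k => by rw [Real.norm_eq_abs]; exact abs_greenIntegrand_le hω x k)
  rw [Real.norm_eq_abs] at h
  simpa using h

/-! ## Bounded solutions of the homogeneous lattice equation vanish -/

/-- **No bounded lattice mode for `ω₂ > 0`**: a bounded `d : ℤ → ℝ` with
`(ω₂ + 2) d(x) = d(x+1) + d(x−1)` for all `x` is identically `0`
(`(ω₂ + 2) sup|d| ≤ 2 sup|d|`). [folklore] -/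
theorem eq_zero_of_bounded_of_lattice_eq {ω₂ : ℝ} (hω : 0 < ω₂) (d : ℤ → ℝ) (B : ℝ)
    (hB : ∀ x, |d x| ≤ B) (hd : ∀ x, (ω₂ + 2) * d x - d (x + 1) - d (x - 1) = 0) (x : ℤ) :
    d x = 0 := by
  have hbdd : BddAbove (Set.range fun x : ℤ => |d x|) := ⟨B, by rintro _ ⟨y, rfl⟩; exact hB y⟩
  set s : ℝ := ⨆ x : ℤ, |d x| with hs
  have hle : ∀ y, |d y| ≤ s := fun y => le_ciSup hbdd y
  have hkey : ∀ y, (ω₂ + 2) * |d y| ≤ 2 * s := by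
    intro y
    have h1 : (ω₂ + 2) * d y = d (y + 1) + d (y - 1) := by linarith [hd y]
    have hpos : (0 : ℝ) < ω₂ + 2 := by linarith
    have h2 : (ω₂ + 2) * |d y| = |d (y + 1) + d (y - 1)| := by
      rw [← h1, abs_mul, abs_of_pos hpos]
    rw [h2]
    exact (abs_add_le _ _).trans (by linarith [hle (y + 1), hle (y - 1)])
  have hs_le : s ≤ 2 * s / (ω₂ + 2) := by
    refine ciSup_le fun y => ?_
    rw [le_div_iff₀ (by linarith)]
    linarith [hkey y]
  have hs0 : s ≤ 0 := by
    rw [le_div_iff₀ (by linarith)] at hs_le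
    nlinarith
  have : |d x| ≤ 0 := (hle x).trans hs0
  exact abs_nonpos_iff.1 this

end Green

/-! ## The registered helper theorem -/

/-- **Registered helper theorem of stub K1 (`stub_harmonicStein`): the lattice equation of the
Green function**, `(ω₂ + 2) G(x) − G(x+1) − G(x−1) = [x = 0]` for `ω₂ > 0`,
`G = HarmonicChaos.greenFn ω₂` (the sibling file's `greenFn_harmonic_identity`). [folklore] -/
theorem harmonicStein_greenLattice :
    ∀ (ω₂ : ℝ), 0 < ω₂ → ∀ x : ℤ,
      (ω₂ + 2) * greenFn ω₂ x - greenFn ω₂ (x + 1) - greenFn ω₂ (x - 1) = if x = 0 then 1 else 0 :=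
  fun _ hω x => greenFn_harmonic_identity hω x

end Summit.AtomisticToContinuum.FouriersLaw.Theorems.DrudeDissolution.GramPencilHarmonicChaos

end
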